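import Summits.Ventures.LatticeQCDFlow.Scoring.UnitaryConjugationLemmas
import Mathlib.Analysis.Complex.Polynomial.Basic
import Literature.RepresentationTheory.CompactGroups.UnitaryGroupCharacters
import HarnessLib

/-!
# The commutant of the congruence action `X ↦ uXuᵀ` of `U(N)` on `M_N(ℂ)`: a linear map commuting with every `X ↦ uXuᵀ` is `X ↦ a·X + b·Xᵀ`

HONEST FRAMING: exact (Metropolis-corrected) sampling algorithms for lattice gauge theory;
figures of merit are autocorrelation/cost numbers at stated couplings and volumes; no
continuum-physics claim.

Venture `LatticeQCDFlow` (cell pub-lqcd), sub-topic `Scoring`; FANOUT row 5 (`s0-sun-a`), GEN-21.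
NEW WORK of the cell (placement rule).  Companion of GEN-20's `AdConjugationCommutant` (the action `X ↦ uXu*`,
commutant `span{id, tr(·)1}`): for the CONGRUENCE action `X ↦ uXuᵀ` of `U(N)` on `M_N(ℂ) ≅ ℂ^N ⊗ ℂ^N` the commutant
is `span{id, transpose}` (equivalently `ℂ^N ⊗ ℂ^N = Sym² ⊕ Λ²`, both irreducible and inequivalent) — the algebraic
input of the exact moment `E (tr W)²` of two-dimensional Wilson loops (sequel), which together with GEN-21's
`E |tr W|²` gives the exact variance of `Re tr W`.  Elementary proof, no representation theory:

* §1 diagonal phases `diag(1,…,i,…,1)`: `uE_{jk}uᵀ = d_j d_k E_{jk}`, so `T(E_{jk})` is supported on `{E_{jk}, E_{kj}}`;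
* §2 permutation matrices (`P_σᵀ = P_σ*`): the three families of constants `T(E_{jk})_{jk}`, `T(E_{jk})_{kj}` (`j ≠ k`)
  and `T(E_{jj})_{jj}` are constant;
* §3 the symmetric unitary `((1+i)·1 + (1−i)·P_τ)/2`: `T(E_{jj})_{jj} = T(E_{pq})_{pq} + T(E_{pq})_{qp}`;
* §4 **`linearMap_eq_of_commute_unitary_congr`** — `T X = a·X + b·Xᵀ` (`N ≥ 2`);
* §5 `SU(N)` suffices (`u = c·v`, `v ∈ SU(N)`, and `uXuᵀ = c²·vXvᵀ`): **`linearMap_eq_of_commute_specialUnitary_congr`**.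

No `def`, nothing cited as a fact, 0 sorry.
-/

noncomputable section

open Matrix Complex

namespace Summit.Ventures.LatticeQCDFlow.Scoring

section Congruence

variable {N : ℕ} (T : Matrix (Fin N) (Fin N) ℂ →ₗ[ℂ] Matrix (Fin N) (Fin N) ℂ)

/-! ### 1. Diagonal phases -/

/-- **The torus test (congruence form).**  If `T` commutes with the congruence by the diagonal phase at `m` and
the phase factors `d_j d_k ≠ d_a d_b`, then `T(E_{jk})_{ab} = 0`. -/
theorem congr_apply_single_entry_eq_zero (hT : ∀ (u : Matrix.unitaryGroup (Fin N) ℂ) (X : Matrix (Fin N) (Fin N) ℂ),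
      T ((u : Matrix (Fin N) (Fin N) ℂ) * X * (u : Matrix (Fin N) (Fin N) ℂ)ᵀ)
        = (u : Matrix (Fin N) (Fin N) ℂ) * T X * (u : Matrix (Fin N) (Fin N) ℂ)ᵀ)
    (j k a b m : Fin N)
    (hne : (if j = m then I else 1) * (if k = m then I else 1) ≠ (if a = m then I else 1) * (if b = m then I else 1)) :
    T (Matrix.single j k 1) a b = 0 := by
  set d : Fin N → ℂ := fun x => if x = m then I else 1 with hd
  have h := hT ⟨Matrix.diagonal d, diagonal_phase_mem_unitaryGroup m⟩ (Matrix.single j k 1)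
  change T (Matrix.diagonal d * Matrix.single j k 1 * (Matrix.diagonal d)ᵀ)
    = Matrix.diagonal d * T (Matrix.single j k 1) * (Matrix.diagonal d)ᵀ at h
  have hdsd : Matrix.diagonal d * Matrix.single j k (1 : ℂ) * Matrix.diagonal d = Matrix.single j k (d j * 1 * d k) := by
    ext x y
    simp only [Matrix.mul_diagonal, Matrix.diagonal_mul, Matrix.single_apply]
    split_ifs with hxy
    · obtain ⟨rfl, rfl⟩ := hxy; ring
    · ring
  rw [Matrix.diagonal_transpose, hdsd] at h
  have hs : Matrix.single j k (d j * 1 * d k) = (d j * d k) • Matrix.single j k (1 : ℂ) := by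
    rw [Matrix.smul_single, smul_eq_mul, mul_one, mul_one]
  rw [hs, map_smul] at h
  have hab := congrFun (congrFun h a) b
  simp only [Matrix.smul_apply, smul_eq_mul, Matrix.mul_diagonal, Matrix.diagonal_mul] at hab
  have hab' : T (Matrix.single j k 1) a b * (d j * d k - d a * d b) = 0 := by linear_combination hab
  rcases mul_eq_zero.1 hab' with h0 | h0
  · exact h0
  · exact absurd (sub_eq_zero.1 h0) hne

/-- `1 ≠ i·x` for `x ∈ {1, i}`: the phase mismatch used below. -/
theorem one_ne_I_mul_ite (P : Prop) [Decidable P] : (1 : ℂ) ≠ I * (if P then I else 1) := by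
  split_ifs
  · rw [Complex.I_mul_I]; intro h; have := congrArg Complex.re h; norm_num at this
  · rw [mul_one]; exact fun h => I_ne_one' h.symm

/-- **Support of `T(E_{jk})`**: `T(E_{jk})_{ab} = 0` unless `(a, b) = (j, k)` or `(a, b) = (k, j)`. -/
theorem congr_apply_single_entry_eq_zero_of_ne (hT : ∀ (u : Matrix.unitaryGroup (Fin N) ℂ) (X : Matrix (Fin N) (Fin N) ℂ),
      T ((u : Matrix (Fin N) (Fin N) ℂ) * X * (u : Matrix (Fin N) (Fin N) ℂ)ᵀ)
        = (u : Matrix (Fin N) (Fin N) ℂ) * T X * (u : Matrix (Fin N) (Fin N) ℂ)ᵀ)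
    {j k a b : Fin N} (h1 : ¬(a = j ∧ b = k)) (h2 : ¬(a = k ∧ b = j)) :
    T (Matrix.single j k 1) a b = 0 := by
  by_cases haj : a = j
  · subst haj
    have hbk : b ≠ k := fun e => h1 ⟨rfl, e⟩
    by_cases hba : b = a
    · subst hba
      -- `a = b = j`, `k ≠ j`: test at `m = k`
      have hkj : ¬ b = k := hbk
      refine congr_apply_single_entry_eq_zero T hT b k b b k ?_
      simp only [hkj, if_false, if_true, one_mul, mul_one]
      exact I_ne_one'
    · -- `a = j`, `b ∉ {j, k}`: test at `m = b`
      refine congr_apply_single_entry_eq_zero T hT a k a b b ?_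
      have hkb : ¬ k = b := fun e => hbk e.symm
      have hab : ¬ a = b := fun e => hba e.symm
      simp only [hab, if_false, hkb, if_true, one_mul]
      exact fun e => I_ne_one' e.symm
  · by_cases hak : a = k
    · subst hak
      have hbj : b ≠ j := fun e => h2 ⟨rfl, e⟩
      by_cases hba : b = a
      · subst hba
        -- `a = b = k`, `j ≠ k`: test at `m = j`
        refine congr_apply_single_entry_eq_zero T hT j b b b j ?_
        have hbj' : ¬ b = j := hbj
        simp only [if_true, hbj', if_false, mul_one]
        exact I_ne_one'
      · -- `a = k`, `b ∉ {j, k}`: test at `m = b`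
        refine congr_apply_single_entry_eq_zero T hT j a a b b ?_
        have hjb : ¬ j = b := fun e => hbj e.symm
        have hab : ¬ a = b := fun e => hba e.symm
        simp only [hjb, if_false, hab, if_true, one_mul, mul_one]
        exact fun e => I_ne_one' e.symm
    · -- `a ∉ {j, k}`: test at `m = a`
      refine congr_apply_single_entry_eq_zero T hT j k a b a ?_
      have hja : ¬ j = a := fun e => haj e.symm
      have hka : ¬ k = a := fun e => hak e.symm
      simp only [hja, if_false, hka, if_true, one_mul]
      exact one_ne_I_mul_ite _

/-- **Off-diagonal matrix units**: `T(E_{jk}) = T(E_{jk})_{jk}·E_{jk} + T(E_{jk})_{kj}·E_{kj}` for `j ≠ k`. -/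
theorem congr_apply_single_of_ne (hT : ∀ (u : Matrix.unitaryGroup (Fin N) ℂ) (X : Matrix (Fin N) (Fin N) ℂ),
      T ((u : Matrix (Fin N) (Fin N) ℂ) * X * (u : Matrix (Fin N) (Fin N) ℂ)ᵀ)
        = (u : Matrix (Fin N) (Fin N) ℂ) * T X * (u : Matrix (Fin N) (Fin N) ℂ)ᵀ)
    {j k : Fin N} (hjk : j ≠ k) :
    T (Matrix.single j k 1) = T (Matrix.single j k 1) j k • Matrix.single j k 1
      + T (Matrix.single j k 1) k j • Matrix.single k j 1 := by
  ext a b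
  rw [Matrix.add_apply, Matrix.smul_apply, Matrix.smul_apply, Matrix.single_apply, Matrix.single_apply, smul_eq_mul,
    smul_eq_mul]
  by_cases h1 : j = a ∧ k = b
  · obtain ⟨rfl, rfl⟩ := h1
    have h2 : ¬(k = j ∧ j = k) := fun e => hjk e.2
    rw [if_pos ⟨rfl, rfl⟩, if_neg h2, mul_one, mul_zero, add_zero]
  · rw [if_neg h1, mul_zero, zero_add]
    by_cases h2 : k = a ∧ j = b
    · obtain ⟨rfl, rfl⟩ := h2
      rw [if_pos ⟨rfl, rfl⟩, mul_one]
    · rw [if_neg h2, mul_zero]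
      exact congr_apply_single_entry_eq_zero_of_ne T hT (fun e => h1 ⟨e.1.symm, e.2.symm⟩)
        (fun e => h2 ⟨e.1.symm, e.2.symm⟩)

/-- **Diagonal matrix units are eigenvectors**: `T(E_{jj}) = T(E_{jj})_{jj}·E_{jj}`. -/
theorem congr_apply_single_same (hT : ∀ (u : Matrix.unitaryGroup (Fin N) ℂ) (X : Matrix (Fin N) (Fin N) ℂ),
      T ((u : Matrix (Fin N) (Fin N) ℂ) * X * (u : Matrix (Fin N) (Fin N) ℂ)ᵀ)
        = (u : Matrix (Fin N) (Fin N) ℂ) * T X * (u : Matrix (Fin N) (Fin N) ℂ)ᵀ) (j : Fin N) :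
    T (Matrix.single j j 1) = T (Matrix.single j j 1) j j • Matrix.single j j 1 := by
  ext a b
  rw [Matrix.smul_apply, Matrix.single_apply, smul_eq_mul]
  by_cases h : j = a ∧ j = b
  · obtain ⟨rfl, rfl⟩ := h
    rw [if_pos ⟨rfl, rfl⟩, mul_one]
  · rw [if_neg h, mul_zero]
    exact congr_apply_single_entry_eq_zero_of_ne T hT (fun e => h ⟨e.1.symm, e.2.symm⟩)
      (fun e => h ⟨e.1.symm, e.2.symm⟩)

/-! ### 2. Permutation covariance -/

/-- The transpose of a permutation matrix is its adjoint (real entries). -/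
theorem transpose_perm_toMatrix (σ : Equiv.Perm (Fin N)) :
    (σ.toPEquiv.toMatrix : Matrix (Fin N) (Fin N) ℂ)ᵀ = star (σ.toPEquiv.toMatrix : Matrix (Fin N) (Fin N) ℂ) := by
  rw [star_perm_toMatrix, ← PEquiv.toMatrix_symm, Equiv.toPEquiv_symm]

/-- **Permutation covariance**: `T(E_{σ⁻¹j, σ⁻¹k}) = (T E_{jk}) ∘ (σ × σ)`. -/
theorem congr_apply_single_perm (hT : ∀ (u : Matrix.unitaryGroup (Fin N) ℂ) (X : Matrix (Fin N) (Fin N) ℂ),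
      T ((u : Matrix (Fin N) (Fin N) ℂ) * X * (u : Matrix (Fin N) (Fin N) ℂ)ᵀ)
        = (u : Matrix (Fin N) (Fin N) ℂ) * T X * (u : Matrix (Fin N) (Fin N) ℂ)ᵀ)
    (σ : Equiv.Perm (Fin N)) (j k : Fin N) :
    T (Matrix.single (σ.symm j) (σ.symm k) 1) = (T (Matrix.single j k 1)).submatrix σ σ := by
  have h := hT ⟨σ.toPEquiv.toMatrix, perm_toMatrix_mem_unitaryGroup σ⟩ (Matrix.single j k 1)
  change T (σ.toPEquiv.toMatrix * Matrix.single j k 1 * (σ.toPEquiv.toMatrix)ᵀ)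
    = σ.toPEquiv.toMatrix * T (Matrix.single j k 1) * (σ.toPEquiv.toMatrix)ᵀ at h
  rw [transpose_perm_toMatrix, perm_conj_eq_submatrix, perm_conj_eq_submatrix, Matrix.submatrix_single_equiv] at h
  exact h

/-- The three families of constants are permutation invariant. -/
theorem congr_coeff_perm (hT : ∀ (u : Matrix.unitaryGroup (Fin N) ℂ) (X : Matrix (Fin N) (Fin N) ℂ),
      T ((u : Matrix (Fin N) (Fin N) ℂ) * X * (u : Matrix (Fin N) (Fin N) ℂ)ᵀ)
        = (u : Matrix (Fin N) (Fin N) ℂ) * T X * (u : Matrix (Fin N) (Fin N) ℂ)ᵀ)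
    (σ : Equiv.Perm (Fin N)) (j k a b : Fin N) :
    T (Matrix.single (σ.symm j) (σ.symm k) 1) (σ.symm a) (σ.symm b) = T (Matrix.single j k 1) a b := by
  rw [congr_apply_single_perm T hT σ j k, Matrix.submatrix_apply, Equiv.apply_symm_apply, Equiv.apply_symm_apply]

/-- **All direct coefficients coincide**: `T(E_{j'k'})_{j'k'} = T(E_{jk})_{jk}` (`j ≠ k`, `j' ≠ k'`). -/
theorem congr_coeff_eq_coeff (hT : ∀ (u : Matrix.unitaryGroup (Fin N) ℂ) (X : Matrix (Fin N) (Fin N) ℂ),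
      T ((u : Matrix (Fin N) (Fin N) ℂ) * X * (u : Matrix (Fin N) (Fin N) ℂ)ᵀ)
        = (u : Matrix (Fin N) (Fin N) ℂ) * T X * (u : Matrix (Fin N) (Fin N) ℂ)ᵀ)
    {j k j' k' : Fin N} (hjk : j ≠ k) (hjk' : j' ≠ k') :
    T (Matrix.single j' k' 1) j' k' = T (Matrix.single j k 1) j k := by
  obtain ⟨σ, hj, hk⟩ := exists_perm_pair hjk hjk'
  rw [← congr_coeff_perm T hT σ j k j k, hj, hk]

/-- **All transposed coefficients coincide**: `T(E_{j'k'})_{k'j'} = T(E_{jk})_{kj}` (`j ≠ k`, `j' ≠ k'`). -/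
theorem congr_coeffT_eq_coeffT (hT : ∀ (u : Matrix.unitaryGroup (Fin N) ℂ) (X : Matrix (Fin N) (Fin N) ℂ),
      T ((u : Matrix (Fin N) (Fin N) ℂ) * X * (u : Matrix (Fin N) (Fin N) ℂ)ᵀ)
        = (u : Matrix (Fin N) (Fin N) ℂ) * T X * (u : Matrix (Fin N) (Fin N) ℂ)ᵀ)
    {j k j' k' : Fin N} (hjk : j ≠ k) (hjk' : j' ≠ k') :
    T (Matrix.single j' k' 1) k' j' = T (Matrix.single j k 1) k j := by
  obtain ⟨σ, hj, hk⟩ := exists_perm_pair hjk hjk'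
  rw [← congr_coeff_perm T hT σ j k k j, hj, hk]

/-- **All diagonal values coincide**: `T(E_{j'j'})_{j'j'} = T(E_{jj})_{jj}`. -/
theorem congr_diag_eq (hT : ∀ (u : Matrix.unitaryGroup (Fin N) ℂ) (X : Matrix (Fin N) (Fin N) ℂ),
      T ((u : Matrix (Fin N) (Fin N) ℂ) * X * (u : Matrix (Fin N) (Fin N) ℂ)ᵀ)
        = (u : Matrix (Fin N) (Fin N) ℂ) * T X * (u : Matrix (Fin N) (Fin N) ℂ)ᵀ) (j j' : Fin N) :
    T (Matrix.single j' j' 1) j' j' = T (Matrix.single j j 1) j j := by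
  have h := congr_coeff_perm T hT (Equiv.swap j' j) j j j j
  rw [Equiv.symm_swap, Equiv.swap_apply_right] at h
  exact h

/-! ### 3. The mixing relation -/

/-- The transposition matrix is symmetric. -/
theorem transpose_swap_toMatrix (p q : Fin N) :
    ((Equiv.swap p q).toPEquiv.toMatrix : Matrix (Fin N) (Fin N) ℂ)ᵀ = (Equiv.swap p q).toPEquiv.toMatrix := by
  rw [transpose_perm_toMatrix, star_swap_toMatrix]

/-- **The mixing relation**: `T(E_{pp})_{pp} = T(E_{pq})_{pq} + T(E_{pq})_{qp}` (`p ≠ q`). -/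
theorem congr_diag_eq_coeff_add (hT : ∀ (u : Matrix.unitaryGroup (Fin N) ℂ) (X : Matrix (Fin N) (Fin N) ℂ),
      T ((u : Matrix (Fin N) (Fin N) ℂ) * X * (u : Matrix (Fin N) (Fin N) ℂ)ᵀ)
        = (u : Matrix (Fin N) (Fin N) ℂ) * T X * (u : Matrix (Fin N) (Fin N) ℂ)ᵀ)
    {p q : Fin N} (hpq : p ≠ q) :
    T (Matrix.single p p 1) p p = T (Matrix.single p q 1) p q + T (Matrix.single p q 1) q p := by
  set P : Matrix (Fin N) (Fin N) ℂ := (Equiv.swap p q).toPEquiv.toMatrix with hP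
  have h := hT ⟨_, mixing_mem_unitaryGroup p q⟩ (Matrix.single p p 1)
  change T ((((1 + I) / 2) • (1 : Matrix (Fin N) (Fin N) ℂ) + ((1 - I) / 2) • P) * Matrix.single p p 1 *
      (((1 + I) / 2) • (1 : Matrix (Fin N) (Fin N) ℂ) + ((1 - I) / 2) • P)ᵀ)
    = (((1 + I) / 2) • (1 : Matrix (Fin N) (Fin N) ℂ) + ((1 - I) / 2) • P) * T (Matrix.single p p 1) *
      (((1 + I) / 2) • (1 : Matrix (Fin N) (Fin N) ℂ) + ((1 - I) / 2) • P)ᵀ at h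
  rw [Matrix.transpose_add, Matrix.transpose_smul, Matrix.transpose_smul, Matrix.transpose_one, hP,
    transpose_swap_toMatrix, smul_one_add_smul_mul_mul, smul_one_add_smul_mul_mul, swap_mul_single_mul_swap,
    swap_mul_single, single_mul_swap, map_add, map_add, map_add, map_smul, map_smul, map_smul, map_smul,
    congr_apply_single_of_ne T hT hpq, congr_apply_single_of_ne T hT (Ne.symm hpq), congr_apply_single_same T hT p,
    congr_apply_single_same T hT q] at h
  -- take the `(p, q)` entry
  have hpq' := congrFun (congrFun h p) q
  simp only [Matrix.add_apply, Matrix.smul_apply, smul_eq_mul, Matrix.single_apply, if_true, and_self, and_true,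
    true_and, if_false, hpq, Ne.symm hpq, mul_one, mul_zero, add_zero, zero_add, Matrix.mul_smul, Matrix.smul_mul, mul_swap_toMatrix_apply, swap_toMatrix_mul_apply,
    Equiv.swap_apply_left, Equiv.swap_apply_right] at hpq'
  have c1 : (1 + I) / 2 * ((1 - I) / 2) = (1 / 2 : ℂ) := by ring_nf; rw [Complex.I_sq]; ring
  have c4 : (1 - I) / 2 * ((1 + I) / 2) = (1 / 2 : ℂ) := by ring_nf; rw [Complex.I_sq]; ring
  rw [c1, c4, congr_coeffT_eq_coeffT T hT hpq (Ne.symm hpq)] at hpq'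
  linear_combination (-2 : ℂ) * hpq'

/-! ### 4. Conclusion -/

/-- **The values of `T` on the matrix units** (`p ≠ q` a reference pair): with `a = T(E_{pq})_{pq}`, `b = T(E_{pq})_{qp}`,
`T(E_{jk}) = a·E_{jk} + b·E_{kj}` for all `j, k`. -/
theorem congr_apply_single_eq (hT : ∀ (u : Matrix.unitaryGroup (Fin N) ℂ) (X : Matrix (Fin N) (Fin N) ℂ),
      T ((u : Matrix (Fin N) (Fin N) ℂ) * X * (u : Matrix (Fin N) (Fin N) ℂ)ᵀ)
        = (u : Matrix (Fin N) (Fin N) ℂ) * T X * (u : Matrix (Fin N) (Fin N) ℂ)ᵀ)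
    {p q : Fin N} (hpq : p ≠ q) (j k : Fin N) :
    T (Matrix.single j k 1) = T (Matrix.single p q 1) p q • Matrix.single j k 1
      + T (Matrix.single p q 1) q p • Matrix.single k j 1 := by
  by_cases hjk : j = k
  · subst hjk
    rw [congr_apply_single_same T hT j, congr_diag_eq T hT p j, congr_diag_eq_coeff_add T hT hpq, add_smul]
  · rw [congr_apply_single_of_ne T hT hjk, congr_coeff_eq_coeff T hT hpq hjk, congr_coeffT_eq_coeffT T hT hpq hjk]

/-- **The commutant of the congruence action of `U(N)` on `M_N(ℂ)`** (`N ≥ 2`): a `ℂ`-linear map `T` on `N × N`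
complex matrices with `T(uXuᵀ) = u T(X) uᵀ` for every unitary `u` is of the form `T(X) = a·X + b·Xᵀ`. -/
theorem linearMap_eq_of_commute_unitary_congr (hN : 2 ≤ N) (hT : ∀ (u : Matrix.unitaryGroup (Fin N) ℂ) (X : Matrix (Fin N) (Fin N) ℂ),
      T ((u : Matrix (Fin N) (Fin N) ℂ) * X * (u : Matrix (Fin N) (Fin N) ℂ)ᵀ)
        = (u : Matrix (Fin N) (Fin N) ℂ) * T X * (u : Matrix (Fin N) (Fin N) ℂ)ᵀ) :
    ∃ a b : ℂ, ∀ X : Matrix (Fin N) (Fin N) ℂ, T X = a • X + b • Xᵀ := by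
  set p : Fin N := ⟨0, by omega⟩
  set q : Fin N := ⟨1, by omega⟩
  have hpq : p ≠ q := by
    intro h
    have := congrArg Fin.val h
    simp [p, q] at this
  refine ⟨T (Matrix.single p q 1) p q, T (Matrix.single p q 1) q p, fun X => ?_⟩
  set a : ℂ := T (Matrix.single p q 1) p q with ha
  set b : ℂ := T (Matrix.single p q 1) q p with hb
  set τ : Matrix (Fin N) (Fin N) ℂ →ₗ[ℂ] Matrix (Fin N) (Fin N) ℂ :=
    { toFun := fun Y => Yᵀ
      map_add' := fun Y Z => Matrix.transpose_add Y Z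
      map_smul' := fun c Y => Matrix.transpose_smul c Y } with hτ
  have hτa : ∀ Y, τ Y = Yᵀ := fun Y => rfl
  set S : Matrix (Fin N) (Fin N) ℂ →ₗ[ℂ] Matrix (Fin N) (Fin N) ℂ := a • LinearMap.id + b • τ with hS
  have hTS : T = S := by
    refine Matrix.ext_linearMap (R := ℂ) fun i j => ?_
    refine LinearMap.ext fun x => ?_
    rw [LinearMap.comp_apply, LinearMap.comp_apply, Matrix.singleLinearMap_apply]
    have hx : Matrix.single i j x = x • Matrix.single i j (1 : ℂ) := by
      rw [Matrix.smul_single, smul_eq_mul, mul_one]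
    have hij := congr_apply_single_eq T hT hpq i j
    rw [← ha, ← hb] at hij
    rw [hx, map_smul, map_smul, hij]
    simp only [hS, LinearMap.add_apply, LinearMap.smul_apply, LinearMap.id_apply, hτa, Matrix.transpose_single]
  rw [hTS]
  simp only [hS, LinearMap.add_apply, LinearMap.smul_apply, LinearMap.id_apply, hτa]

/-! ### 5. From `SU(N)` to `U(N)` -/

/-- **Congruence covariance under `SU(N)` implies congruence covariance under `U(N)`**: `u = c·v` with `v ∈ SU(N)`
and `uXuᵀ = c²·vXvᵀ`, and `T` is linear. -/
theorem commute_unitary_congr_of_specialUnitary [NeZero N]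
    (hT : ∀ (v : Matrix.specialUnitaryGroup (Fin N) ℂ) (X : Matrix (Fin N) (Fin N) ℂ),
      T ((v : Matrix (Fin N) (Fin N) ℂ) * X * (v : Matrix (Fin N) (Fin N) ℂ)ᵀ)
        = (v : Matrix (Fin N) (Fin N) ℂ) * T X * (v : Matrix (Fin N) (Fin N) ℂ)ᵀ)
    (u : Matrix.unitaryGroup (Fin N) ℂ) (X : Matrix (Fin N) (Fin N) ℂ) :
    T ((u : Matrix (Fin N) (Fin N) ℂ) * X * (u : Matrix (Fin N) (Fin N) ℂ)ᵀ)
      = (u : Matrix (Fin N) (Fin N) ℂ) * T X * (u : Matrix (Fin N) (Fin N) ℂ)ᵀ := by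
  have hN : 0 < N := Nat.pos_of_ne_zero (NeZero.ne N)
  obtain ⟨c, hc⟩ := IsAlgClosed.exists_pow_nat_eq ((u : Matrix (Fin N) (Fin N) ℂ).det) hN
  have hdet : ‖(u : Matrix (Fin N) (Fin N) ℂ).det‖ = 1 :=
    Literature.RepresentationTheory.CompactGroups.UnitaryGroupChar.norm_det_eq_one u
  have hc1 : ‖c‖ = 1 := by
    have h : ‖c‖ ^ N = 1 := by rw [← norm_pow, hc, hdet]
    exact (pow_eq_one_iff_of_nonneg (norm_nonneg c) hN.ne').1 h
  have hc0 : c ≠ 0 := fun h => by rw [h, norm_zero] at hc1; exact zero_ne_one hc1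
  have hcc : c * (starRingEnd ℂ) c = 1 := by
    rw [Complex.mul_conj, Complex.normSq_eq_norm_sq, hc1]; norm_num
  have hcinv : c⁻¹ * (starRingEnd ℂ) c⁻¹ = 1 := by
    rw [map_inv₀, ← mul_inv, hcc, inv_one]
  have hvu : c⁻¹ • (u : Matrix (Fin N) (Fin N) ℂ) ∈ Matrix.unitaryGroup (Fin N) ℂ := by
    rw [Matrix.mem_unitaryGroup_iff, star_smul, Matrix.smul_mul, Matrix.mul_smul, smul_smul,
      Matrix.mem_unitaryGroup_iff.mp u.2, Complex.star_def, hcinv, one_smul]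
  have hvdet : (c⁻¹ • (u : Matrix (Fin N) (Fin N) ℂ)).det = 1 := by
    rw [Matrix.det_smul, Fintype.card_fin, ← hc, inv_pow, inv_mul_cancel₀ (pow_ne_zero _ hc0)]
  have hvsu : c⁻¹ • (u : Matrix (Fin N) (Fin N) ℂ) ∈ Matrix.specialUnitaryGroup (Fin N) ℂ :=
    Matrix.mem_specialUnitaryGroup_iff.2 ⟨hvu, hvdet⟩
  have h := hT ⟨c⁻¹ • (u : Matrix (Fin N) (Fin N) ℂ), hvsu⟩ X
  change T (c⁻¹ • (u : Matrix (Fin N) (Fin N) ℂ) * X * (c⁻¹ • (u : Matrix (Fin N) (Fin N) ℂ))ᵀ)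
    = c⁻¹ • (u : Matrix (Fin N) (Fin N) ℂ) * T X * (c⁻¹ • (u : Matrix (Fin N) (Fin N) ℂ))ᵀ at h
  rw [Matrix.transpose_smul, Matrix.smul_mul, Matrix.smul_mul, Matrix.mul_smul, smul_smul, map_smul,
    Matrix.smul_mul, Matrix.smul_mul, Matrix.mul_smul, smul_smul] at h
  have hc2 : c⁻¹ * c⁻¹ ≠ 0 := mul_ne_zero (inv_ne_zero hc0) (inv_ne_zero hc0)
  exact smul_right_injective _ hc2 h

/-- **The commutant, `SU(N)` form** (`N ≥ 2`): a `ℂ`-linear map on `M_N(ℂ)` with `T(vXvᵀ) = v T(X) vᵀ` for every special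
unitary `v` is `X ↦ a·X + b·Xᵀ`. -/
theorem linearMap_eq_of_commute_specialUnitary_congr (hN : 2 ≤ N)
    (hT : ∀ (v : Matrix.specialUnitaryGroup (Fin N) ℂ) (X : Matrix (Fin N) (Fin N) ℂ),
      T ((v : Matrix (Fin N) (Fin N) ℂ) * X * (v : Matrix (Fin N) (Fin N) ℂ)ᵀ)
        = (v : Matrix (Fin N) (Fin N) ℂ) * T X * (v : Matrix (Fin N) (Fin N) ℂ)ᵀ) :
    ∃ a b : ℂ, ∀ X : Matrix (Fin N) (Fin N) ℂ, T X = a • X + b • Xᵀ := by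
  haveI : NeZero N := ⟨by omega⟩
  exact linearMap_eq_of_commute_unitary_congr T hN (commute_unitary_congr_of_specialUnitary T hT)

end Congruence

end Summit.Ventures.LatticeQCDFlow.Scoring
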